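import Mathlib
import Summits.NavierStokesRegularity.NavierStokesRegularity.Theses.FilamentSkeletonRss
import Summits.NavierStokesRegularity.NavierStokesRegularity.Theorems.FilamentSkeletonRssSkeletonJ1GStubStraightDatum

/-!
# `FilamentSkeletonRss` · crux `SkeletonJ1G` (stmt-NavierStokesRegularity-27849) · THE SPLIT GLUE
# `SkeletonJ1G ⇐ TangentSkeletonNearStraight ∧ Clause13NearStraight ∧ NormalBlockMatched` (sorry-free)

TENURE g16 RESYNC (planner-ns-filament-repair-plan-g16-0, 2026-08-28T15:3xZ) of the strategist's file `Cruxes/SkeletonJ1G/SplitGlue.lean`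
(sha16 605935caa3b45b70, cstrat-27849 g2): child 3 `NormalBlockMatched` is the RESHAPED registered stub S4 (`FlatJ1G → NearStraightJ1G →
Clause12J1G`, skeleton of record 888398bc7a8b5bf0) instead of the pre-reshape cut; the composition passes the near-straightness
witness `hns` that child 1 already delivers (one extra argument in §4); everything else verbatim.  The route child item
`FilamentSkeletonRss.NormalBlockMatched` is restated 1:1 to the §5 inlined text of this file (tenure `route edit --restate`).

Crux-strategist gen 2 (`cstrat-stmt-NavierStokesRegularity-27849-s1-g2`, 2026-08-28), filed `--supports stmt-27849 --as helper`.
Purpose: the DECOMPOSITION of the deciding ∃-crux `SkeletonJ1G` of route `FilamentSkeletonRss` into three typed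
sub-cruxes, with the implication PROVED here so that the route can be split
(`ledger route edit … --split SkeletonJ1G --into … --glue-by …skeletonJ1G_of_subs`).

The cut is the one of the REGISTERED skeleton of record `Cruxes/SkeletonJ1/Lines/near_straight_newton.lean`
(sha16 `425a2bdc735ccf75`; stubs S1–S4, composition `SkeletonJ1G_of_hyps`), whose stub S1 `stub_straightDatum`
(a straight skew datum exists) LANDED as `Theorems/FilamentSkeletonRssSkeletonJ1GStubStraightDatum.lean` (p640971).
With S1 a theorem, `SkeletonJ1G` follows from the three remaining stub STATEMENTS by pure logic; this file proves exactly
that, in route vocabulary (the line file is not importable from `Theorems/`, so its piece predicates `FlatJ1G`,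
`NearStraightJ1G`, `Clause12J1G`, `Clause13J1G`, `StraightDatum` are re-declared here VERBATIM, §1).

THE THREE SUB-CRUXES (§2; each also written out fully inlined in the binder types of `skeletonJ1G_of_subs`, §5 — those
inlined texts are the statements filed as the route's children, and `…_iff` certify they are the §2 predicates by `Iff.rfl`):
* `TangentSkeletonNearStraight` (XL, the heart) — the registered S2 `TangentSkeletonFromStraight` with ONE extra
  hypothesis, GENERAL POSITION of the datum's directions `|⟪t j, t k⟫| ≤ 1 − θ₀ (j ≠ k)`: from every general-position
  straight skew datum, for every small near-straightness tolerance `Rb` and all large `Γ`, an EXACTLY TANGENT core-matched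
  skeleton with the datum's `(N, γ, α)` satisfying the flat clauses 0–11 + area law + cone bound with relaxed constants,
  `2Kρ ≤ 1`, near-straight to tolerance `Rb`.  (S2 ⇒ this, trivially: `tangentSkeletonNearStraight_of_fromStraight`.
  Why the extra hypothesis: for EXACTLY (anti)parallel datum pairs the in-ball `S`-bending — odd displacement
  `≈ (A/6)·Rb³·√(log Γ)` waist units at the ball edge, `A = 4π α |e₃ × t|/(γ log Γ)`-normalised — is not absorbed by a
  tolerance chosen after the datum, so a perturbative proof must first move such a datum into general position; the
  hypothesis pre-pays that step on the ∃ side, where it is free: the landed witness has `⟪t₀, t₁⟫ = 7/25`.)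
* `Clause13NearStraight` (M–L) — registered S3 verbatim: clause 13-J (weighted injectivity of the linearised normal
  velocity on ball-supported normal variations modulo the `e₃`-rotation) for near-straight exactly tangent skeletons.
* `NormalBlockMatched` (M) — registered S4 verbatim: clause 12 (normal block: trace `< 0`, determinant `> 0`) from the
  flat clauses with the matched kernel.

§3 re-proves the landed datum with the general-position conjunct added (`straightDatumGP_exists`; same rational witness,
same helper lemmas, one more `fin_cases` bullet: `|⟪t₀, t₁⟫| = 7/25 ≤ 5/6`).  §4 is the composition (constants threaded
`Rb := min Rb₀ Rb₁`, `η := 1`, `Γ₂ := max Γ₂ (max Γ₀ Γ₁)`; the port of `SkeletonJ1G_of_hyps`).  No statement about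
Navier–Stokes regularity or blow-up is proved here: this is glue (three open hypotheses ⇒ the crux). [folklore]
-/

set_option linter.dupNamespace false

noncomputable section

namespace Summit.NavierStokesRegularity.NavierStokesRegularity.Theorems.FilamentSkeletonRssSkeletonJ1GSplit

open scoped BigOperators Topology InnerProductSpace
open Filter Set Function MeasureTheory
open Literature.Analysis.FluidPDE
open Summit.NavierStokesRegularity.NavierStokesRegularity.Theses.FilamentSkeletonRss
open Summit.NavierStokesRegularity.NavierStokesRegularity.Theorems.SelectionBoxRJRung
open Summit.NavierStokesRegularity.NavierStokesRegularity.Theorems.FilamentSkeletonRssSkeletonJ1GStubStraightDatum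
open Summit.NavierStokesRegularity.NavierStokesRegularity.Theorems.FilamentSkeletonRssSkeletonJ1GStubStraightDatumSlip

/-! ## §1 The piece predicates of the registered skeleton, verbatim -/

/-- The matrix of `SkeletonJ1G` — everything after `∀ Γ ≥ Γ₂, ∃ data` — VERBATIM. [folklore] -/
def J1GMatrix (N : ℕ) (δ ρ K Λ a b cnd Rw Rb cg θ₀ KA Γ : ℝ) (γ : Fin N → ℝ) (α : ℝ) (X : Fin N → ℝ → EuclideanSpace ℝ (Fin 3))
    (w : Fin N → ℝ → ℝ) (c : Fin N → ℝ) (m n : Fin N → EuclideanSpace ℝ (Fin 3)) (Aa : Fin N → ℝ → ℝ) : Prop :=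
  ∀ (u:(Fin N → ℝ → EuclideanSpace ℝ (Fin 3)) → EuclideanSpace ℝ (Fin 3) → EuclideanSpace ℝ (Fin 3)) (v:EuclideanSpace ℝ (Fin 3) → EuclideanSpace ℝ (Fin 3)) (A:Fin N → (EuclideanSpace ℝ (Fin 3) →L[ℝ] EuclideanSpace ℝ (Fin 3))) (T:(Fin N → ℝ → EuclideanSpace ℝ (Fin 3)) → Fin N → ℝ → EuclideanSpace ℝ (Fin 3)), (∀ Z y, u Z y = ∑ k, (Γ*γ k/(4*Real.pi))•∫ σ:ℝ, ((‖y-Z k σ‖^2+Real.exp (-(1+Real.eulerMascheroniConstant-Real.log 2))*Aa k σ)^(3/2:ℝ))⁻¹•cross (deriv (Z k) σ) (y-Z k σ))→(∀ y, v y = u X y+(1/2:ℝ)•y-α•cross (EuclideanSpace.single 2 1) y)→(∀ j, A j = fderiv ℝ v (X j (c j)))→(∀ Z j τ, T Z j τ = (u Z (Z j τ)+(1/2:ℝ)•Z j τ-α•cross (EuclideanSpace.single 2 1) (Z j τ))-(⟪u Z (Z j τ)+(1/2:ℝ)•Z j τ-α•cross (EuclideanSpace.single 2 1) (Z j τ),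 deriv (Z j) τ⟫_ℝ/‖deriv (Z j) τ‖^2)•deriv (Z j) τ)→(α ≠ 0 ∧ (∀ j, γ j ≠ 0) ∧ (∀ j, ContDiff ℝ 2 (X j) ∧ Differentiable ℝ (w j)∧(∀ τ, ‖deriv (X j) τ‖ = 1)∧(∀ τ, ‖iteratedDeriv 2 (X j) τ‖*√Γ≤K) ∧ Tendsto (fun τ => ‖X j τ‖) (cocompact ℝ) atTop) ∧ (∀ j k, j ≠ k → ∀ τ σ, ρ*√Γ≤‖X j τ-X k σ‖) ∧ (∀ j τ σ, ρ*√Γ≤|τ-σ| → cg*ρ*√Γ≤‖X j τ-X j σ‖) ∧ (∀ j τ, cg*|τ-c j|≤Rw*√Γ+‖X j τ‖) ∧ (∀ j τ, w j τ = ⟪v (X j τ), deriv (X j) τ⟫_ℝ) ∧ (∀ j τ, ‖X j τ‖≤Rb*√(Γ*Real.log Γ) → v (X j τ) = w j τ•deriv (X j) τ) ∧ (∀ j, ‖X j (c j)‖≤Rw*√Γ) ∧ (∀ j, |⟪deriv (X j) (c j), EuclideanSpace.single 2 1⟫_ℝ|≤1-θ₀) ∧ (θ₀≤|α| ∧ |α|≤θ₀⁻¹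 ∧ ∀ j, θ₀≤|γ j| ∧ |γ j|≤θ₀⁻¹) ∧ (∀ j, w j (c j) = 0 ∧ (∀ τ, w j τ = 0 → τ = c j) ∧ 3/2+δ≤deriv (w j) (c j) ∧ deriv (w j) (c j)≤Λ) ∧ (∀ j, Differentiable ℝ (Aa j) ∧ (∀ τ, 0 < Aa j τ) ∧ ∀ τ, w j τ*deriv (Aa j) τ = (3/2-deriv (w j) τ)*Aa j τ+4) ∧ (∀ j τ, Rw^2*Γ*Aa j τ≤KA*(Rw^2*Γ+‖X j τ‖^2)) ∧ (∀ j, Orthonormal ℝ ![deriv (X j) (c j), m j, n j] ∧ ⟪A j (m j), m j⟫_ℝ+⟪A j (n j), n j⟫_ℝ < 0 ∧ ⟪A j (n j), m j⟫_ℝ * ⟪A j (m j), n j⟫_ℝ < ⟪A j (m j), m j⟫_ℝ * ⟪A j (n j), n j⟫_ℝ) ∧ (∀ Y:Fin N → ℝ → EuclideanSpace ℝ (Fin 3), (∀ j, ContDiff ℝ 2 (Y j))→(∀ j τ, ⟪Y j τ, deriv (X j) τ⟫_ℝ = 0) → (∀ j τ, Rb*√(Γ*Real.log Γ) < ‖X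 j τ‖ → Y j τ = 0) → ∑ j, ⟪Y j (c j), cross (EuclideanSpace.single 2 1) (X j (c j))⟫_ℝ = 0 → (∀ j τ, ‖Y j τ‖+‖deriv (Y j) τ‖+‖iteratedDeriv 2 (Y j) τ‖≤(1+|τ-c j|)^b) → ∀ L:ℝ, (∀ j τ, ‖deriv (fun s:ℝ => T (fun k σ => X k σ+s•Y k σ) j τ) 0‖≤L*(1+|τ-c j|)^a) → ∀ j τ, ‖Y j τ‖≤cnd*L*(1+|τ-c j|)^b))

/-- FLAT PART of the matrix: clauses 0–11, the area law and the Γ-flat cone bound, verbatim. [folklore] -/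
def FlatJ1G (N : ℕ) (δ ρ K Λ Rw Rb cg θ₀ KA Γ : ℝ) (γ : Fin N → ℝ) (α : ℝ) (X : Fin N → ℝ → EuclideanSpace ℝ (Fin 3))
    (w : Fin N → ℝ → ℝ) (c : Fin N → ℝ) (Aa : Fin N → ℝ → ℝ) : Prop :=
  ∀ (u:(Fin N → ℝ → EuclideanSpace ℝ (Fin 3)) → EuclideanSpace ℝ (Fin 3) → EuclideanSpace ℝ (Fin 3)) (v:EuclideanSpace ℝ (Fin 3) → EuclideanSpace ℝ (Fin 3)) (A:Fin N → (EuclideanSpace ℝ (Fin 3) →L[ℝ] EuclideanSpace ℝ (Fin 3))) (T:(Fin N → ℝ → EuclideanSpace ℝ (Fin 3)) → Fin N → ℝ → EuclideanSpace ℝ (Fin 3)), (∀ Z y, u Z y = ∑ k, (Γ*γ k/(4*Real.pi))•∫ σ:ℝ, ((‖y-Z k σ‖^2+Real.exp (-(1+Real.eulerMascheroniConstant-Real.log 2))*Aa k σ)^(3/2:ℝ))⁻¹•cross (deriv (Z k) σ) (y-Z k σ))→(∀ y, v y = u X y+(1/2:ℝ)•y-α•cross (EuclideanSpace.single 2 1)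 y)→(∀ j, A j = fderiv ℝ v (X j (c j)))→(∀ Z j τ, T Z j τ = (u Z (Z j τ)+(1/2:ℝ)•Z j τ-α•cross (EuclideanSpace.single 2 1) (Z j τ))-(⟪u Z (Z j τ)+(1/2:ℝ)•Z j τ-α•cross (EuclideanSpace.single 2 1) (Z j τ), deriv (Z j) τ⟫_ℝ/‖deriv (Z j) τ‖^2)•deriv (Z j) τ)→(α ≠ 0 ∧ (∀ j, γ j ≠ 0) ∧ (∀ j, ContDiff ℝ 2 (X j) ∧ Differentiable ℝ (w j)∧(∀ τ, ‖deriv (X j) τ‖ = 1)∧(∀ τ, ‖iteratedDeriv 2 (X j) τ‖*√Γ≤K) ∧ Tendsto (fun τ => ‖X j τ‖) (cocompact ℝ) atTop) ∧ (∀ j k, j ≠ k → ∀ τ σ, ρ*√Γ≤‖X j τ-X k σ‖) ∧ (∀ j τ σ, ρ*√Γ≤|τ-σ| → cg*ρ*√Γ≤‖X j τ-X j σ‖) ∧ (∀ j τ, cg*|τ-c j|≤Rw*√Γ+‖X j τ‖) ∧ (∀ j τ, w j τ = ⟪v (X j τ), deriv (X j) τ⟫_ℝ) ∧ (∀ j τ,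 ‖X j τ‖≤Rb*√(Γ*Real.log Γ) → v (X j τ) = w j τ•deriv (X j) τ) ∧ (∀ j, ‖X j (c j)‖≤Rw*√Γ) ∧ (∀ j, |⟪deriv (X j) (c j), EuclideanSpace.single 2 1⟫_ℝ|≤1-θ₀) ∧ (θ₀≤|α| ∧ |α|≤θ₀⁻¹ ∧ ∀ j, θ₀≤|γ j| ∧ |γ j|≤θ₀⁻¹) ∧ (∀ j, w j (c j) = 0 ∧ (∀ τ, w j τ = 0 → τ = c j) ∧ 3/2+δ≤deriv (w j) (c j) ∧ deriv (w j) (c j)≤Λ) ∧ (∀ j, Differentiable ℝ (Aa j) ∧ (∀ τ, 0 < Aa j τ) ∧ ∀ τ, w j τ*deriv (Aa j) τ = (3/2-deriv (w j) τ)*Aa j τ+4) ∧ (∀ j τ, Rw^2*Γ*Aa j τ≤KA*(Rw^2*Γ+‖X j τ‖^2)))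

/-- CLAUSE 12 (normal block at the stagnation points) for SOME normal frames `m n`, verbatim. [folklore] -/
def Clause12J1G (N : ℕ) (Γ : ℝ) (γ : Fin N → ℝ) (α : ℝ) (X : Fin N → ℝ → EuclideanSpace ℝ (Fin 3)) (_w : Fin N → ℝ → ℝ)
    (c : Fin N → ℝ) (Aa : Fin N → ℝ → ℝ) : Prop :=
  ∃ (m n : Fin N → EuclideanSpace ℝ (Fin 3)), ∀ (u:(Fin N → ℝ → EuclideanSpace ℝ (Fin 3)) → EuclideanSpace ℝ (Fin 3) → EuclideanSpace ℝ (Fin 3)) (v:EuclideanSpace ℝ (Fin 3) → EuclideanSpace ℝ (Fin 3)) (A:Fin N → (EuclideanSpace ℝ (Fin 3) →L[ℝ] EuclideanSpace ℝ (Fin 3))) (T:(Fin N → ℝ → EuclideanSpace ℝ (Fin 3)) → Fin N → ℝ → EuclideanSpace ℝ (Fin 3)), (∀ Z y, u Z y = ∑ k, (Γ*γ k/(4*Real.pi))•∫ σ:ℝ, ((‖y-Z k σ‖^2+Real.exp (-(1+Real.eulerMascheroniConstant-Real.log 2))*Aa k σ)^(3/2:ℝ))⁻¹•cross (deriv (Z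 k) σ) (y-Z k σ))→(∀ y, v y = u X y+(1/2:ℝ)•y-α•cross (EuclideanSpace.single 2 1) y)→(∀ j, A j = fderiv ℝ v (X j (c j)))→(∀ Z j τ, T Z j τ = (u Z (Z j τ)+(1/2:ℝ)•Z j τ-α•cross (EuclideanSpace.single 2 1) (Z j τ))-(⟪u Z (Z j τ)+(1/2:ℝ)•Z j τ-α•cross (EuclideanSpace.single 2 1) (Z j τ), deriv (Z j) τ⟫_ℝ/‖deriv (Z j) τ‖^2)•deriv (Z j) τ)→(∀ j, Orthonormal ℝ ![deriv (X j) (c j), m j, n j] ∧ ⟪A j (m j), m j⟫_ℝ+⟪A j (n j), n j⟫_ℝ < 0 ∧ ⟪A j (n j), m j⟫_ℝ * ⟪A j (m j), n j⟫_ℝ < ⟪A j (m j), m j⟫_ℝ * ⟪A j (n j), n j⟫_ℝ)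

/-- CLAUSE 13-J (weighted injectivity of the linearised normal-velocity map), verbatim. [folklore] -/
def Clause13J1G (N : ℕ) (a b cnd Rb Γ : ℝ) (γ : Fin N → ℝ) (α : ℝ) (X : Fin N → ℝ → EuclideanSpace ℝ (Fin 3)) (_w : Fin N → ℝ → ℝ)
    (c : Fin N → ℝ) (Aa : Fin N → ℝ → ℝ) : Prop :=
  ∀ (u:(Fin N → ℝ → EuclideanSpace ℝ (Fin 3)) → EuclideanSpace ℝ (Fin 3) → EuclideanSpace ℝ (Fin 3)) (v:EuclideanSpace ℝ (Fin 3) → EuclideanSpace ℝ (Fin 3)) (A:Fin N → (EuclideanSpace ℝ (Fin 3) →L[ℝ] EuclideanSpace ℝ (Fin 3))) (T:(Fin N → ℝ → EuclideanSpace ℝ (Fin 3)) → Fin N → ℝ → EuclideanSpace ℝ (Fin 3)), (∀ Z y, u Z y = ∑ k, (Γ*γ k/(4*Real.pi))•∫ σ:ℝ, ((‖y-Z k σ‖^2+Real.exp (-(1+Real.eulerMascheroniConstant-Real.log 2))*Aa k σ)^(3/2:ℝ))⁻¹•cross (deriv (Z k) σ) (y-Z k σ))→(∀ y, v y = u X y+(1/2:ℝ)•y-α•cross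 (EuclideanSpace.single 2 1) y)→(∀ j, A j = fderiv ℝ v (X j (c j)))→(∀ Z j τ, T Z j τ = (u Z (Z j τ)+(1/2:ℝ)•Z j τ-α•cross (EuclideanSpace.single 2 1) (Z j τ))-(⟪u Z (Z j τ)+(1/2:ℝ)•Z j τ-α•cross (EuclideanSpace.single 2 1) (Z j τ), deriv (Z j) τ⟫_ℝ/‖deriv (Z j) τ‖^2)•deriv (Z j) τ)→(∀ Y:Fin N → ℝ → EuclideanSpace ℝ (Fin 3), (∀ j, ContDiff ℝ 2 (Y j))→(∀ j τ, ⟪Y j τ, deriv (X j) τ⟫_ℝ = 0) → (∀ j τ, Rb*√(Γ*Real.log Γ) < ‖X j τ‖ → Y j τ = 0) → ∑ j, ⟪Y j (c j), cross (EuclideanSpace.single 2 1) (X j (c j))⟫_ℝ = 0 → (∀ j τ, ‖Y j τ‖+‖deriv (Y j) τ‖+‖iteratedDeriv 2 (Y j) τ‖≤(1+|τ-c j|)^b) → ∀ L:ℝ, (∀ j τ, ‖deriv (fun s:ℝ => T (fun k σ => X k σ+s•Y k σ) j τ) 0‖≤L*(1+|τ-c j|)^a) → ∀ j τ, ‖Y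 j τ‖≤cnd*L*(1+|τ-c j|)^b)

/-- THE NEAR-STRAIGHT REGIME: tangent oscillation `≤ Rb`, global slip-slope bound, core-area floor. [folklore] -/
def NearStraightJ1G (N : ℕ) (Λ Rb : ℝ) (X : Fin N → ℝ → EuclideanSpace ℝ (Fin 3)) (w : Fin N → ℝ → ℝ) (Aa : Fin N → ℝ → ℝ) : Prop :=
  (∀ j τ σ, ‖deriv (X j) τ - deriv (X j) σ‖ ≤ Rb) ∧ (∀ j τ, |deriv (w j) τ| ≤ Λ) ∧ (∀ j τ, Λ⁻¹ ≤ Aa j τ)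

/-- A STRAIGHT SKEW DATUM (Γ-free, finite-dimensional), verbatim from the registered line. [folklore] -/
def StraightDatum (N : ℕ) (δ ρ Λ Rw θ₀ mw : ℝ) (p t : Fin N → EuclideanSpace ℝ (Fin 3)) (γ : Fin N → ℝ) (α : ℝ)
    (s₀ : Fin N → ℝ) : Prop :=
  (∀ j, ‖t j‖ = 1) ∧ (∀ j k, j ≠ k → ∀ τ σ : ℝ, ρ ≤ ‖(p j + τ • t j) - (p k + σ • t k)‖) ∧ (∀ j, |⟪t j, EuclideanSpace.single 2 1⟫_ℝ| ≤ 1 - θ₀) ∧ (θ₀ ≤ |α| ∧ |α| ≤ θ₀⁻¹ ∧ ∀ j, θ₀ ≤ |γ j| ∧ |γ j| ≤ θ₀⁻¹) ∧ (∀ j, ‖p j + s₀ j • t j‖ ≤ Rw) ∧ (∀ W : Fin N → ℝ → ℝ, (∀ j s, W j s = ⟪(∑ k ∈ Finset.univ.erase j, (γ k / (2 * Real.pi)) • ((‖(p j + s • t j - p k) - ⟪p j + s • t j - p k, t k⟫_ℝ • t k‖ ^ 2)⁻¹ • cross (t k) ((p j + s • t j - p k) - ⟪p j + s • t j - p k,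 t k⟫_ℝ • t k))) + (1 / 2 : ℝ) • (p j + s • t j) - α • cross (EuclideanSpace.single 2 1) (p j + s • t j), t j⟫_ℝ) → ∀ j, W j (s₀ j) = 0 ∧ (∀ s, mw * |s - s₀ j| ≤ |W j s|) ∧ 3 / 2 + δ ≤ deriv (W j) (s₀ j) ∧ (∀ s, |deriv (W j) s| ≤ Λ))

/-! ## §2 The three sub-cruxes (structured forms) and the registered S2 -/

/-- SUB-CRUX 1 (XL): exactly tangent near-straight core-matched skeletons shadow every GENERAL-POSITION straight skew
datum, for every small tolerance `Rb` and all large `Γ`. (route-posited stub statement; not a Literature fact) -/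
def TangentSkeletonNearStraight : Prop :=
  ∀ (N : ℕ) (δd ρd Λd Rwd θd mw : ℝ) (p t : Fin N → EuclideanSpace ℝ (Fin 3)) (γ : Fin N → ℝ) (α : ℝ) (s₀ : Fin N → ℝ),
    0 < N → 0 < δd → 0 < ρd → 0 < Rwd → 0 < θd → 0 < mw → StraightDatum N δd ρd Λd Rwd θd mw p t γ α s₀ →
    (∀ j k, j ≠ k → |⟪t j, t k⟫_ℝ| ≤ 1 - θd) →
    ∃ (δ ρ K Λ Rw cg θ₀ KA Rb₁ : ℝ), 0 < δ ∧ 0 < ρ ∧ 0 < Rw ∧ 0 < cg ∧ 0 < θ₀ ∧ 0 < Rb₁ ∧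
      2 * K * ρ ≤ 1 ∧ ∀ Rb : ℝ, 0 < Rb → Rb ≤ Rb₁ → ∃ Γ₂ : ℝ, ∀ Γ : ℝ, Γ₂ ≤ Γ →
        ∃ (X : Fin N → ℝ → EuclideanSpace ℝ (Fin 3)) (w : Fin N → ℝ → ℝ) (c : Fin N → ℝ) (Aa : Fin N → ℝ → ℝ),
          FlatJ1G N δ ρ K Λ Rw Rb cg θ₀ KA Γ γ α X w c Aa ∧ NearStraightJ1G N Λ Rb X w Aa

/-- SUB-CRUX 2 (M–L): clause 13-J for near-straight exactly tangent skeletons, `Rb ≤ Rb₀(consts)`, `Γ ≥ Γ₀(consts, Rb)`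
(registered S3 verbatim). (route-posited stub statement; not a Literature fact) -/
def Clause13NearStraight : Prop :=
  ∀ (N : ℕ) (δ ρ K Λ Rw cg θ₀ KA : ℝ), 0 < N → 0 < δ → 0 < ρ → 0 < Rw → 0 < cg → 0 < θ₀ →
    ∃ Rb₀ : ℝ, 0 < Rb₀ ∧ ∀ Rb : ℝ, 0 < Rb → Rb ≤ Rb₀ → ∃ (a b cnd Γ₀ : ℝ), 0 ≤ a ∧ 0 < cnd ∧
      ∀ Γ : ℝ, Γ₀ ≤ Γ → ∀ (γ : Fin N → ℝ) (α : ℝ) (X : Fin N → ℝ → EuclideanSpace ℝ (Fin 3)) (w : Fin N → ℝ → ℝ)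
        (c : Fin N → ℝ) (Aa : Fin N → ℝ → ℝ),
        FlatJ1G N δ ρ K Λ Rw Rb cg θ₀ KA Γ γ α X w c Aa → NearStraightJ1G N Λ Rb X w Aa →
          Clause13J1G N a b cnd Rb Γ γ α X w c Aa

/-- SUB-CRUX 3 (M): the normal block (clause 12) from the flat clauses IN THE NEAR-STRAIGHT REGIME (hypothesis
`NearStraightJ1G`: tangent oscillation `≤ Rb`, `|w′| ≤ Λ`, core-area floor `Λ⁻¹ ≤ Aa`), matched kernel, `2Kρ ≤ 1`,
`Γ ≥ Γ₀(consts)` — the RESHAPED registered S4 (skeleton of record 888398bc7a8b5bf0, lane 19175-p1 g11 reshape adopted by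
tenure g16 at 2026-08-28T15:05:01Z; the area floor is what the matched-kernel port of `clause12_of_skeleton` needs). (route-posited stub statement; not a Literature fact) -/
def NormalBlockMatched : Prop :=
  ∀ (N : ℕ) (δ ρ K Λ Rw Rb cg θ₀ KA : ℝ), 0 < N → 0 < δ → 0 < ρ → 0 < Rw → 0 < Rb → 0 < cg → 0 < θ₀ →
    2 * K * ρ ≤ 1 → ∃ Γ₀ : ℝ, ∀ Γ : ℝ, Γ₀ ≤ Γ → ∀ (γ : Fin N → ℝ) (α : ℝ) (X : Fin N → ℝ → EuclideanSpace ℝ (Fin 3))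
      (w : Fin N → ℝ → ℝ) (c : Fin N → ℝ) (Aa : Fin N → ℝ → ℝ),
      FlatJ1G N δ ρ K Λ Rw Rb cg θ₀ KA Γ γ α X w c Aa → NearStraightJ1G N Λ Rb X w Aa → Clause12J1G N Γ γ α X w c Aa

/-- The registered S2 `TangentSkeletonFromStraight` (no general-position hypothesis), verbatim. (route-posited stub statement; not a Literature fact) -/
def TangentSkeletonFromStraight : Prop :=
  ∀ (N : ℕ) (δ ρ Λ Rw θ₀ mw : ℝ) (p t : Fin N → EuclideanSpace ℝ (Fin 3)) (γ : Fin N → ℝ) (α : ℝ) (s₀ : Fin N → ℝ),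
    0 < N → 0 < δ → 0 < ρ → 0 < Rw → 0 < θ₀ → 0 < mw → StraightDatum N δ ρ Λ Rw θ₀ mw p t γ α s₀ →
    ∃ (δ' ρ' K Λ' Rw' cg θ₀' KA Rb₁ : ℝ), 0 < δ' ∧ 0 < ρ' ∧ 0 < Rw' ∧ 0 < cg ∧ 0 < θ₀' ∧ 0 < Rb₁ ∧
      2 * K * ρ' ≤ 1 ∧ ∀ Rb : ℝ, 0 < Rb → Rb ≤ Rb₁ → ∃ Γ₂ : ℝ, ∀ Γ : ℝ, Γ₂ ≤ Γ →
        ∃ (X : Fin N → ℝ → EuclideanSpace ℝ (Fin 3)) (w : Fin N → ℝ → ℝ) (c : Fin N → ℝ) (Aa : Fin N → ℝ → ℝ),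
          FlatJ1G N δ' ρ' K Λ' Rw' Rb cg θ₀' KA Γ γ α X w c Aa ∧ NearStraightJ1G N Λ' Rb X w Aa

/-- The registered S2 implies sub-crux 1 (drop the general-position hypothesis). [folklore] -/
theorem tangentSkeletonNearStraight_of_fromStraight (h : TangentSkeletonFromStraight) : TangentSkeletonNearStraight :=
  fun N δd ρd Λd Rwd θd mw p t γ α s₀ hN hδ hρ hRw hθ hmw hSD _ => h N δd ρd Λd Rwd θd mw p t γ α s₀ hN hδ hρ hRw hθ hmw hSD

/-! ## §3 The general-position datum (the landed rational witness, one more conjunct) -/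

/-- GENERAL POSITION of the witness directions: `⟪t₀, t₁⟫ = 7/25`, so `|⟪t₀, t₁⟫| ≤ 1 − 1/6`. [folklore] -/
theorem inner_tangents_zero_one :
    |⟪(WithLp.toLp 2 ![0, 3 / 5, 4 / 5] : EuclideanSpace ℝ (Fin 3)), (WithLp.toLp 2 ![0, -(3 / 5), 4 / 5] : EuclideanSpace ℝ (Fin 3))⟫_ℝ| ≤ 1 - 1 / 6 := by
  rw [inner_vec3]; norm_num [abs_of_pos]

/-- The other ordering. [folklore] -/
theorem inner_tangents_one_zero :
    |⟪(WithLp.toLp 2 ![0, -(3 / 5), 4 / 5] : EuclideanSpace ℝ (Fin 3)), (WithLp.toLp 2 ![0, 3 / 5, 4 / 5] : EuclideanSpace ℝ (Fin 3))⟫_ℝ| ≤ 1 - 1 / 6 := by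
  rw [inner_vec3]; norm_num [abs_of_pos]

/-- **A GENERAL-POSITION STRAIGHT SKEW DATUM EXISTS** — the landed witness of `stub_straightDatum` (p640971: `N = 2`,
`δ = 1/4`, `ρ = 4/25`, `Λ = 22`, `Rw = 3/5`, `θ₀ = 1/6`, `mw = 1/10`, `p = (±2/25, 0, 0)`, `t = (0, ±3/5, 4/5)`,
`γ ≡ 125π/108`, `α = 875/432`, `s₀ ≡ −1/2`) with the extra conjunct `|⟪t j, t k⟫| ≤ 1 − θ₀` (`= 7/25 ≤ 5/6`).
Same proof as the landed theorem, from its public helper lemmas. [folklore] -/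
theorem straightDatumGP_exists :
    ∃ (N : ℕ) (δ ρ Λ Rw θ₀ mw : ℝ) (p t : Fin N → EuclideanSpace ℝ (Fin 3)) (γ : Fin N → ℝ) (α : ℝ) (s₀ : Fin N → ℝ),
      0 < N ∧ 0 < δ ∧ 0 < ρ ∧ 0 < Rw ∧ 0 < θ₀ ∧ 0 < mw ∧ StraightDatum N δ ρ Λ Rw θ₀ mw p t γ α s₀ ∧
      (∀ j k, j ≠ k → |⟪t j, t k⟫_ℝ| ≤ 1 - θ₀) := by
  refine ⟨2, 1 / 4, 4 / 25, 22, 3 / 5, 1 / 6, 1 / 10,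
    ![(WithLp.toLp 2 ![2 / 25, 0, 0] : EuclideanSpace ℝ (Fin 3)), WithLp.toLp 2 ![-(2 / 25), 0, 0]],
    ![(WithLp.toLp 2 ![0, 3 / 5, 4 / 5] : EuclideanSpace ℝ (Fin 3)), WithLp.toLp 2 ![0, -(3 / 5), 4 / 5]],
    fun _ => 125 * Real.pi / 108, 875 / 432, fun _ => -1 / 2,
    by norm_num, by norm_num, by norm_num, by norm_num, by norm_num, by norm_num, ⟨?_, ?_, ?_, ?_, ?_, ?_⟩, ?_⟩
  · -- unit tangents
    intro j
    fin_cases j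
    · simp only [Fin.zero_eta, Fin.isValue, Matrix.cons_val_zero]
      exact norm_tangent_zero
    · simp only [Fin.mk_one, Fin.isValue, Matrix.cons_val_one, Matrix.cons_val_zero]
      exact norm_tangent_one
  · -- pairwise separation of the two lines
    intro j k hjk τ σ
    fin_cases j <;> fin_cases k
    · exact absurd rfl hjk
    · simp only [Fin.zero_eta, Fin.mk_one, Fin.isValue, Matrix.cons_val_zero, Matrix.cons_val_one]
      exact separation_zero_one τ σ
    · simp only [Fin.zero_eta, Fin.mk_one, Fin.isValue, Matrix.cons_val_zero, Matrix.cons_val_one]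
      exact separation_one_zero τ σ
    · exact absurd rfl hjk
  · -- tilt margin θ₀ = 1/6
    intro j
    fin_cases j
    · simp only [Fin.zero_eta, Fin.isValue, Matrix.cons_val_zero]
      exact tilt_zero
    · simp only [Fin.mk_one, Fin.isValue, Matrix.cons_val_one, Matrix.cons_val_zero]
      exact tilt_one
  · -- parameter bounds
    refine ⟨by norm_num, by norm_num, fun _ => ?_⟩
    exact gamma_bounds
  · -- waist
    intro j
    fin_cases j
    · simp only [Fin.zero_eta, Fin.isValue, Matrix.cons_val_zero]
      exact waist_zero
    · simp only [Fin.mk_one, Fin.isValue, Matrix.cons_val_one, Matrix.cons_val_zero]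
      exact waist_one
  · -- the scaled slip: closed form on each line, then zero / transversality / slope / slope bound
    intro W hW
    have he0 : Finset.univ.erase (0 : Fin 2) = {1} := by decide
    have he1 : Finset.univ.erase (1 : Fin 2) = {0} := by decide
    have key0 : ∀ s, W 0 s = 125 / 36 / (1 + 36 * s ^ 2) + s / 2 - 7 / 72 := by
      intro s
      rw [hW, he0, Finset.sum_singleton]
      simp only [Fin.isValue, Matrix.cons_val_zero, Matrix.cons_val_one]
      exact slip_closed_form_zero s
    have key1 : ∀ s, W 1 s = 125 / 36 / (1 + 36 * s ^ 2) + s / 2 - 7 / 72 := by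
      intro s
      rw [hW, he1, Finset.sum_singleton]
      simp only [Fin.isValue, Matrix.cons_val_zero, Matrix.cons_val_one]
      exact slip_closed_form_one s
    have hf0 : W 0 = fun s => 125 / 36 / (1 + 36 * s ^ 2) + s / 2 - 7 / 72 := funext key0
    have hf1 : W 1 = fun s => 125 / 36 / (1 + 36 * s ^ 2) + s / 2 - 7 / 72 := funext key1
    intro j
    fin_cases j
    · simp only [Fin.zero_eta, Fin.isValue]
      refine ⟨?_, ?_, ?_, ?_⟩
      · rw [key0]; norm_num
      · intro s; rw [key0]; exact slip_transversal s
      · rw [hf0]; exact deriv_slip_zero.symm.le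
      · intro s; rw [hf0]; exact abs_deriv_slip_le s
    · simp only [Fin.mk_one, Fin.isValue]
      refine ⟨?_, ?_, ?_, ?_⟩
      · rw [key1]; norm_num
      · intro s; rw [key1]; exact slip_transversal s
      · rw [hf1]; exact deriv_slip_zero.symm.le
      · intro s; rw [hf1]; exact abs_deriv_slip_le s
  · -- general position of the directions
    intro j k hjk
    fin_cases j <;> fin_cases k
    · exact absurd rfl hjk
    · simp only [Fin.zero_eta, Fin.mk_one, Fin.isValue, Matrix.cons_val_zero, Matrix.cons_val_one]
      exact inner_tangents_zero_one
    · simp only [Fin.zero_eta, Fin.mk_one, Fin.isValue, Matrix.cons_val_zero, Matrix.cons_val_one]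
      exact inner_tangents_one_zero
    · exact absurd rfl hjk

/-! ## §4 Composition (pure logic) -/

/-- `J1GMatrix` is the matrix of the route decl `SkeletonJ1G` verbatim (definitional `Iff.rfl`). [folklore] -/
theorem skeletonJ1G_iff_matrix :
    SkeletonJ1G ↔ ∃ (N : ℕ) (δ ρ K Λ a b cnd η Rw Rb cg θ₀ KA Γ₂ : ℝ), 0 < N ∧ 0 < δ ∧ 0 < ρ ∧ 0 ≤ a ∧ 0 < cnd ∧
      0 < η ∧ 0 < Rw ∧ 0 < Rb ∧ 0 < cg ∧ 0 < θ₀ ∧ ∀ Γ : ℝ, Γ₂ ≤ Γ →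
        ∃ (γ : Fin N → ℝ) (α : ℝ) (X : Fin N → ℝ → EuclideanSpace ℝ (Fin 3)) (w : Fin N → ℝ → ℝ) (c : Fin N → ℝ)
          (m n : Fin N → EuclideanSpace ℝ (Fin 3)) (Aa : Fin N → ℝ → ℝ), J1GMatrix N δ ρ K Λ a b cnd Rw Rb cg θ₀ KA Γ γ α X w c m n Aa :=
  Iff.rfl

/-- COMPOSITION through the matrix: the three sub-cruxes imply the matrix form of `SkeletonJ1G`; the datum is the landed
general-position witness (§3).  Constants threaded `Rb := min Rb₀ Rb₁`, `η := 1`, `Γ₂ := max Γ₂ (max Γ₀ Γ₁)`; then the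
flat clauses, clause 12 and clause 13-J are re-assembled in the crux's order. [folklore] -/
theorem skeletonJ1G_matrix_of_pieces (h2 : TangentSkeletonNearStraight) (h3 : Clause13NearStraight)
    (h4 : NormalBlockMatched) :
    ∃ (N : ℕ) (δ ρ K Λ a b cnd η Rw Rb cg θ₀ KA Γ₂ : ℝ), 0 < N ∧ 0 < δ ∧ 0 < ρ ∧ 0 ≤ a ∧ 0 < cnd ∧
      0 < η ∧ 0 < Rw ∧ 0 < Rb ∧ 0 < cg ∧ 0 < θ₀ ∧ ∀ Γ : ℝ, Γ₂ ≤ Γ →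
        ∃ (γ : Fin N → ℝ) (α : ℝ) (X : Fin N → ℝ → EuclideanSpace ℝ (Fin 3)) (w : Fin N → ℝ → ℝ) (c : Fin N → ℝ)
          (m n : Fin N → EuclideanSpace ℝ (Fin 3)) (Aa : Fin N → ℝ → ℝ), J1GMatrix N δ ρ K Λ a b cnd Rw Rb cg θ₀ KA Γ γ α X w c m n Aa := by
  obtain ⟨N, δd, ρd, Λd, Rwd, θd, mw, p, t, γ, α, s₀, hN, hδ, hρ, hRw, hθ, hmw, hSD, hGP⟩ := straightDatumGP_exists
  obtain ⟨δ', ρ', K, Λ', Rw', cg, θ₀', KA, Rb₁, hδ', hρ', hRw', hcg, hθ₀', hRb₁, hKρ, hfam⟩ :=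
    h2 N δd ρd Λd Rwd θd mw p t γ α s₀ hN hδ hρ hRw hθ hmw hSD hGP
  obtain ⟨Rb₀, hRb₀, h13⟩ := h3 N δ' ρ' K Λ' Rw' cg θ₀' KA hN hδ' hρ' hRw' hcg hθ₀'
  have hRb : 0 < min Rb₀ Rb₁ := lt_min hRb₀ hRb₁
  obtain ⟨a, b, cnd, Γ₀, ha, hcnd, h13'⟩ := h13 (min Rb₀ Rb₁) hRb (min_le_left _ _)
  obtain ⟨Γ₂, hfam'⟩ := hfam (min Rb₀ Rb₁) hRb (min_le_right _ _)
  obtain ⟨Γ₁, h12⟩ := h4 N δ' ρ' K Λ' Rw' (min Rb₀ Rb₁) cg θ₀' KA hN hδ' hρ' hRw' hRb hcg hθ₀' hKρ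
  refine ⟨N, δ', ρ', K, Λ', a, b, cnd, 1, Rw', min Rb₀ Rb₁, cg, θ₀', KA, max Γ₂ (max Γ₀ Γ₁), hN, hδ', hρ', ha, hcnd,
    one_pos, hRw', hRb, hcg, hθ₀', ?_⟩
  intro Γ hΓ
  have hΓ₂ : Γ₂ ≤ Γ := le_trans (le_max_left _ _) hΓ
  have hΓ₀ : Γ₀ ≤ Γ := le_trans (le_trans (le_max_left _ _) (le_max_right _ _)) hΓ
  have hΓ₁ : Γ₁ ≤ Γ := le_trans (le_trans (le_max_right _ _) (le_max_right _ _)) hΓ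
  obtain ⟨X, w, c, Aa, hflat, hns⟩ := hfam' Γ hΓ₂
  have hc13 := h13' Γ hΓ₀ γ α X w c Aa hflat hns
  obtain ⟨m, n, hc12⟩ := h12 Γ hΓ₁ γ α X w c Aa hflat hns
  refine ⟨γ, α, X, w, c, m, n, Aa, ?_⟩
  intro u v A T hu hv hA hT
  obtain ⟨k0, k1, k2, k3, k4, k5, k6, k7, k8, k9, k10, k11, k12, k13⟩ := hflat u v A T hu hv hA hT
  exact ⟨k0, k1, k2, k3, k4, k5, k6, k7, k8, k9, k10, k11, k12, k13, hc12 u v A T hu hv hA hT, hc13 u v A T hu hv hA hT⟩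

/-- **THE SPLIT IMPLICATION (structured form)**: `TangentSkeletonNearStraight → Clause13NearStraight → NormalBlockMatched →
SkeletonJ1G`, the crux BY NAME. [folklore] -/
theorem skeletonJ1G_of_pieces (h2 : TangentSkeletonNearStraight) (h3 : Clause13NearStraight) (h4 : NormalBlockMatched) :
    SkeletonJ1G :=
  skeletonJ1G_iff_matrix.mpr (skeletonJ1G_matrix_of_pieces h2 h3 h4)

/-- The registered line's cut still concludes the crux: S2 ∧ S3 ∧ S4 ⇒ `SkeletonJ1G` (S1 landed). [folklore] -/
theorem skeletonJ1G_of_registered (h2 : TangentSkeletonFromStraight) (h3 : Clause13NearStraight)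
    (h4 : NormalBlockMatched) : SkeletonJ1G :=
  skeletonJ1G_of_pieces (tangentSkeletonNearStraight_of_fromStraight h2) h3 h4

/-! ## §5 The route-vocabulary (fully inlined) children and the glue theorem `skeletonJ1G_of_subs` -/

/-- Child 1 as filed on the route (fully inlined) is `TangentSkeletonNearStraight` (definitional). [folklore] -/
theorem tangentSkeletonNearStraight_iff :
    (open Literature.Analysis.FluidPDE in ∀ (N : ℕ) (δd ρd Λd Rwd θd mw : ℝ) (p t : Fin N → EuclideanSpace ℝ (Fin 3)) (γ : Fin N → ℝ) (α : ℝ) (s₀ : Fin N → ℝ), 0 < N → 0 < δd → 0 < ρd → 0 < Rwd → 0 < θd → 0 < mw → ((∀ j, ‖t j‖ = 1) ∧ (∀ j k, j ≠ k → ∀ τ σ : ℝ, ρd ≤ ‖(p j + τ • t j) - (p k + σ • t k)‖) ∧ (∀ j, |⟪t j, EuclideanSpace.single 2 1⟫_ℝ| ≤ 1 - θd) ∧ (θd ≤ |α| ∧ |α| ≤ θd⁻¹ ∧ ∀ j, θd ≤ |γ j| ∧ |γ j| ≤ θd⁻¹) ∧ (∀ j, ‖p j + s₀ j • t j‖ ≤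 Rwd) ∧ (∀ W : Fin N → ℝ → ℝ, (∀ j s, W j s = ⟪(∑ k ∈ Finset.univ.erase j, (γ k / (2 * Real.pi)) • ((‖(p j + s • t j - p k) - ⟪p j + s • t j - p k, t k⟫_ℝ • t k‖ ^ 2)⁻¹ • cross (t k) ((p j + s • t j - p k) - ⟪p j + s • t j - p k, t k⟫_ℝ • t k))) + (1 / 2 : ℝ) • (p j + s • t j) - α • cross (EuclideanSpace.single 2 1) (p j + s • t j), t j⟫_ℝ) → ∀ j, W j (s₀ j) = 0 ∧ (∀ s, mw * |s - s₀ j| ≤ |W j s|) ∧ 3 / 2 + δd ≤ deriv (W j) (s₀ j) ∧ (∀ s, |deriv (W j) s| ≤ Λd))) → (∀ j k, j ≠ k → |⟪t j, t k⟫_ℝ| ≤ 1 - θd) → ∃ (δ ρ K Λ Rw cg θ₀ KA Rb₁ : ℝ), 0 < δ ∧ 0 < ρ ∧ 0 < Rw ∧ 0 < cg ∧ 0 < θ₀ ∧ 0 < Rb₁ ∧ 2 * K * ρ ≤ 1 ∧ ∀ Rb : ℝ, 0 < Rb → Rb ≤ Rb₁ → ∃ Γ₂ : ℝ, ∀ Γ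 : ℝ, Γ₂ ≤ Γ → ∃ (X : Fin N → ℝ → EuclideanSpace ℝ (Fin 3)) (w : Fin N → ℝ → ℝ) (c : Fin N → ℝ) (Aa : Fin N → ℝ → ℝ), (∀ (u:(Fin N → ℝ → EuclideanSpace ℝ (Fin 3)) → EuclideanSpace ℝ (Fin 3) → EuclideanSpace ℝ (Fin 3)) (v:EuclideanSpace ℝ (Fin 3) → EuclideanSpace ℝ (Fin 3)) (A:Fin N → (EuclideanSpace ℝ (Fin 3) →L[ℝ] EuclideanSpace ℝ (Fin 3))) (T:(Fin N → ℝ → EuclideanSpace ℝ (Fin 3)) → Fin N → ℝ → EuclideanSpace ℝ (Fin 3)), (∀ Z y, u Z y = ∑ k, (Γ*γ k/(4*Real.pi))•∫ σ:ℝ, ((‖y-Z k σ‖^2+Real.exp (-(1+Real.eulerMascheroniConstant-Real.log 2))*Aa k σ)^(3/2:ℝ))⁻¹•cross (deriv (Z k) σ) (y-Z k σ))→(∀ y, v y = u X y+(1/2:ℝ)•y-α•cross (EuclideanSpace.single 2 1) y)→(∀ j, A j = fderiv ℝ v (X j (c j)))→(∀ Z j τ, T Z j τ = (u Z (Z j τ)+(1/2:ℝ)•Z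 j τ-α•cross (EuclideanSpace.single 2 1) (Z j τ))-(⟪u Z (Z j τ)+(1/2:ℝ)•Z j τ-α•cross (EuclideanSpace.single 2 1) (Z j τ), deriv (Z j) τ⟫_ℝ/‖deriv (Z j) τ‖^2)•deriv (Z j) τ)→(α ≠ 0 ∧ (∀ j, γ j ≠ 0) ∧ (∀ j, ContDiff ℝ 2 (X j) ∧ Differentiable ℝ (w j)∧(∀ τ, ‖deriv (X j) τ‖ = 1)∧(∀ τ, ‖iteratedDeriv 2 (X j) τ‖*√Γ≤K) ∧ Tendsto (fun τ => ‖X j τ‖) (cocompact ℝ) atTop) ∧ (∀ j k, j ≠ k → ∀ τ σ, ρ*√Γ≤‖X j τ-X k σ‖) ∧ (∀ j τ σ, ρ*√Γ≤|τ-σ| → cg*ρ*√Γ≤‖X j τ-X j σ‖) ∧ (∀ j τ, cg*|τ-c j|≤Rw*√Γ+‖X j τ‖) ∧ (∀ j τ, w j τ = ⟪v (X j τ), deriv (X j) τ⟫_ℝ) ∧ (∀ j τ, ‖X j τ‖≤Rb*√(Γ*Real.log Γ) → v (X j τ) = w j τ•deriv (X j) τ) ∧ (∀ j, ‖X j (c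 j)‖≤Rw*√Γ) ∧ (∀ j, |⟪deriv (X j) (c j), EuclideanSpace.single 2 1⟫_ℝ|≤1-θ₀) ∧ (θ₀≤|α| ∧ |α|≤θ₀⁻¹ ∧ ∀ j, θ₀≤|γ j| ∧ |γ j|≤θ₀⁻¹) ∧ (∀ j, w j (c j) = 0 ∧ (∀ τ, w j τ = 0 → τ = c j) ∧ 3/2+δ≤deriv (w j) (c j) ∧ deriv (w j) (c j)≤Λ) ∧ (∀ j, Differentiable ℝ (Aa j) ∧ (∀ τ, 0 < Aa j τ) ∧ ∀ τ, w j τ*deriv (Aa j) τ = (3/2-deriv (w j) τ)*Aa j τ+4) ∧ (∀ j τ, Rw^2*Γ*Aa j τ≤KA*(Rw^2*Γ+‖X j τ‖^2)))) ∧ ((∀ j τ σ, ‖deriv (X j) τ - deriv (X j) σ‖ ≤ Rb) ∧ (∀ j τ, |deriv (w j) τ| ≤ Λ) ∧ (∀ j τ, Λ⁻¹ ≤ Aa j τ))) ↔ TangentSkeletonNearStraight :=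
  Iff.rfl

/-- Child 2 as filed on the route (fully inlined) is `Clause13NearStraight` (definitional). [folklore] -/
theorem clause13NearStraight_iff :
    (open Literature.Analysis.FluidPDE in ∀ (N : ℕ) (δ ρ K Λ Rw cg θ₀ KA : ℝ), 0 < N → 0 < δ → 0 < ρ → 0 < Rw → 0 < cg → 0 < θ₀ → ∃ Rb₀ : ℝ, 0 < Rb₀ ∧ ∀ Rb : ℝ, 0 < Rb → Rb ≤ Rb₀ → ∃ (a b cnd Γ₀ : ℝ), 0 ≤ a ∧ 0 < cnd ∧ ∀ Γ : ℝ, Γ₀ ≤ Γ → ∀ (γ : Fin N → ℝ) (α : ℝ) (X : Fin N → ℝ → EuclideanSpace ℝ (Fin 3)) (w : Fin N → ℝ → ℝ) (c : Fin N → ℝ) (Aa : Fin N → ℝ → ℝ), (∀ (u:(Fin N → ℝ → EuclideanSpace ℝ (Fin 3)) → EuclideanSpace ℝ (Fin 3) → EuclideanSpace ℝ (Fin 3)) (v:EuclideanSpace ℝ (Fin 3) → EuclideanSpace ℝ (Fin 3)) (A:Fin N → (EuclideanSpace ℝ (Fin 3) →L[ℝ] EuclideanSpace ℝ (Fin 3)))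 (T:(Fin N → ℝ → EuclideanSpace ℝ (Fin 3)) → Fin N → ℝ → EuclideanSpace ℝ (Fin 3)), (∀ Z y, u Z y = ∑ k, (Γ*γ k/(4*Real.pi))•∫ σ:ℝ, ((‖y-Z k σ‖^2+Real.exp (-(1+Real.eulerMascheroniConstant-Real.log 2))*Aa k σ)^(3/2:ℝ))⁻¹•cross (deriv (Z k) σ) (y-Z k σ))→(∀ y, v y = u X y+(1/2:ℝ)•y-α•cross (EuclideanSpace.single 2 1) y)→(∀ j, A j = fderiv ℝ v (X j (c j)))→(∀ Z j τ, T Z j τ = (u Z (Z j τ)+(1/2:ℝ)•Z j τ-α•cross (EuclideanSpace.single 2 1) (Z j τ))-(⟪u Z (Z j τ)+(1/2:ℝ)•Z j τ-α•cross (EuclideanSpace.single 2 1) (Z j τ), deriv (Z j) τ⟫_ℝ/‖deriv (Z j) τ‖^2)•deriv (Z j) τ)→(α ≠ 0 ∧ (∀ j, γ j ≠ 0) ∧ (∀ j, ContDiff ℝ 2 (X j) ∧ Differentiable ℝ (w j)∧(∀ τ, ‖deriv (X j) τ‖ = 1)∧(∀ τ, ‖iteratedDeriv 2 (X j) τ‖*√Γ≤K)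 ∧ Tendsto (fun τ => ‖X j τ‖) (cocompact ℝ) atTop) ∧ (∀ j k, j ≠ k → ∀ τ σ, ρ*√Γ≤‖X j τ-X k σ‖) ∧ (∀ j τ σ, ρ*√Γ≤|τ-σ| → cg*ρ*√Γ≤‖X j τ-X j σ‖) ∧ (∀ j τ, cg*|τ-c j|≤Rw*√Γ+‖X j τ‖) ∧ (∀ j τ, w j τ = ⟪v (X j τ), deriv (X j) τ⟫_ℝ) ∧ (∀ j τ, ‖X j τ‖≤Rb*√(Γ*Real.log Γ) → v (X j τ) = w j τ•deriv (X j) τ) ∧ (∀ j, ‖X j (c j)‖≤Rw*√Γ) ∧ (∀ j, |⟪deriv (X j) (c j), EuclideanSpace.single 2 1⟫_ℝ|≤1-θ₀) ∧ (θ₀≤|α| ∧ |α|≤θ₀⁻¹ ∧ ∀ j, θ₀≤|γ j| ∧ |γ j|≤θ₀⁻¹) ∧ (∀ j, w j (c j) = 0 ∧ (∀ τ, w j τ = 0 → τ = c j) ∧ 3/2+δ≤deriv (w j) (c j) ∧ deriv (w j) (c j)≤Λ) ∧ (∀ j, Differentiable ℝ (Aa j) ∧ (∀ τ, 0 < Aa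 j τ) ∧ ∀ τ, w j τ*deriv (Aa j) τ = (3/2-deriv (w j) τ)*Aa j τ+4) ∧ (∀ j τ, Rw^2*Γ*Aa j τ≤KA*(Rw^2*Γ+‖X j τ‖^2)))) → ((∀ j τ σ, ‖deriv (X j) τ - deriv (X j) σ‖ ≤ Rb) ∧ (∀ j τ, |deriv (w j) τ| ≤ Λ) ∧ (∀ j τ, Λ⁻¹ ≤ Aa j τ)) → (∀ (u:(Fin N → ℝ → EuclideanSpace ℝ (Fin 3)) → EuclideanSpace ℝ (Fin 3) → EuclideanSpace ℝ (Fin 3)) (v:EuclideanSpace ℝ (Fin 3) → EuclideanSpace ℝ (Fin 3)) (A:Fin N → (EuclideanSpace ℝ (Fin 3) →L[ℝ] EuclideanSpace ℝ (Fin 3))) (T:(Fin N → ℝ → EuclideanSpace ℝ (Fin 3)) → Fin N → ℝ → EuclideanSpace ℝ (Fin 3)), (∀ Z y, u Z y = ∑ k, (Γ*γ k/(4*Real.pi))•∫ σ:ℝ, ((‖y-Z k σ‖^2+Real.exp (-(1+Real.eulerMascheroniConstant-Real.log 2))*Aa k σ)^(3/2:ℝ))⁻¹•cross (deriv (Z k)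 σ) (y-Z k σ))→(∀ y, v y = u X y+(1/2:ℝ)•y-α•cross (EuclideanSpace.single 2 1) y)→(∀ j, A j = fderiv ℝ v (X j (c j)))→(∀ Z j τ, T Z j τ = (u Z (Z j τ)+(1/2:ℝ)•Z j τ-α•cross (EuclideanSpace.single 2 1) (Z j τ))-(⟪u Z (Z j τ)+(1/2:ℝ)•Z j τ-α•cross (EuclideanSpace.single 2 1) (Z j τ), deriv (Z j) τ⟫_ℝ/‖deriv (Z j) τ‖^2)•deriv (Z j) τ)→(∀ Y:Fin N → ℝ → EuclideanSpace ℝ (Fin 3), (∀ j, ContDiff ℝ 2 (Y j))→(∀ j τ, ⟪Y j τ, deriv (X j) τ⟫_ℝ = 0) → (∀ j τ, Rb*√(Γ*Real.log Γ) < ‖X j τ‖ → Y j τ = 0) → ∑ j, ⟪Y j (c j), cross (EuclideanSpace.single 2 1) (X j (c j))⟫_ℝ = 0 → (∀ j τ, ‖Y j τ‖+‖deriv (Y j) τ‖+‖iteratedDeriv 2 (Y j) τ‖≤(1+|τ-c j|)^b) → ∀ L:ℝ, (∀ j τ, ‖deriv (fun s:ℝ => T (fun k σ => X k σ+s•Y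 k σ) j τ) 0‖≤L*(1+|τ-c j|)^a) → ∀ j τ, ‖Y j τ‖≤cnd*L*(1+|τ-c j|)^b))) ↔ Clause13NearStraight :=
  Iff.rfl

/-- Child 3 as filed on the route (fully inlined) is `NormalBlockMatched` (definitional). [folklore] -/
theorem normalBlockMatched_iff :
    (open Literature.Analysis.FluidPDE in ∀ (N : ℕ) (δ ρ K Λ Rw Rb cg θ₀ KA : ℝ), 0 < N → 0 < δ → 0 < ρ → 0 < Rw → 0 < Rb → 0 < cg → 0 < θ₀ → 2 * K * ρ ≤ 1 → ∃ Γ₀ : ℝ, ∀ Γ : ℝ, Γ₀ ≤ Γ → ∀ (γ : Fin N → ℝ) (α : ℝ) (X : Fin N → ℝ → EuclideanSpace ℝ (Fin 3)) (w : Fin N → ℝ → ℝ) (c : Fin N → ℝ) (Aa : Fin N → ℝ → ℝ), (∀ (u:(Fin N → ℝ → EuclideanSpace ℝ (Fin 3)) → EuclideanSpace ℝ (Fin 3) → EuclideanSpace ℝ (Fin 3)) (v:EuclideanSpace ℝ (Fin 3) → EuclideanSpace ℝ (Fin 3)) (A:Fin N → (EuclideanSpace ℝ (Fin 3) →L[ℝ]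 EuclideanSpace ℝ (Fin 3))) (T:(Fin N → ℝ → EuclideanSpace ℝ (Fin 3)) → Fin N → ℝ → EuclideanSpace ℝ (Fin 3)), (∀ Z y, u Z y = ∑ k, (Γ*γ k/(4*Real.pi))•∫ σ:ℝ, ((‖y-Z k σ‖^2+Real.exp (-(1+Real.eulerMascheroniConstant-Real.log 2))*Aa k σ)^(3/2:ℝ))⁻¹•cross (deriv (Z k) σ) (y-Z k σ))→(∀ y, v y = u X y+(1/2:ℝ)•y-α•cross (EuclideanSpace.single 2 1) y)→(∀ j, A j = fderiv ℝ v (X j (c j)))→(∀ Z j τ, T Z j τ = (u Z (Z j τ)+(1/2:ℝ)•Z j τ-α•cross (EuclideanSpace.single 2 1) (Z j τ))-(⟪u Z (Z j τ)+(1/2:ℝ)•Z j τ-α•cross (EuclideanSpace.single 2 1) (Z j τ), deriv (Z j) τ⟫_ℝ/‖deriv (Z j) τ‖^2)•deriv (Z j) τ)→(α ≠ 0 ∧ (∀ j, γ j ≠ 0) ∧ (∀ j, ContDiff ℝ 2 (X j) ∧ Differentiable ℝ (w j)∧(∀ τ, ‖deriv (X j) τ‖ = 1)∧(∀ τ, ‖iteratedDeriv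 2 (X j) τ‖*√Γ≤K) ∧ Tendsto (fun τ => ‖X j τ‖) (cocompact ℝ) atTop) ∧ (∀ j k, j ≠ k → ∀ τ σ, ρ*√Γ≤‖X j τ-X k σ‖) ∧ (∀ j τ σ, ρ*√Γ≤|τ-σ| → cg*ρ*√Γ≤‖X j τ-X j σ‖) ∧ (∀ j τ, cg*|τ-c j|≤Rw*√Γ+‖X j τ‖) ∧ (∀ j τ, w j τ = ⟪v (X j τ), deriv (X j) τ⟫_ℝ) ∧ (∀ j τ, ‖X j τ‖≤Rb*√(Γ*Real.log Γ) → v (X j τ) = w j τ•deriv (X j) τ) ∧ (∀ j, ‖X j (c j)‖≤Rw*√Γ) ∧ (∀ j, |⟪deriv (X j) (c j), EuclideanSpace.single 2 1⟫_ℝ|≤1-θ₀) ∧ (θ₀≤|α| ∧ |α|≤θ₀⁻¹ ∧ ∀ j, θ₀≤|γ j| ∧ |γ j|≤θ₀⁻¹) ∧ (∀ j, w j (c j) = 0 ∧ (∀ τ, w j τ = 0 → τ = c j) ∧ 3/2+δ≤deriv (w j) (c j) ∧ deriv (w j) (c j)≤Λ) ∧ (∀ j, Differentiable ℝ (Aa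 j) ∧ (∀ τ, 0 < Aa j τ) ∧ ∀ τ, w j τ*deriv (Aa j) τ = (3/2-deriv (w j) τ)*Aa j τ+4) ∧ (∀ j τ, Rw^2*Γ*Aa j τ≤KA*(Rw^2*Γ+‖X j τ‖^2)))) → ((∀ j τ σ, ‖deriv (X j) τ - deriv (X j) σ‖ ≤ Rb) ∧ (∀ j τ, |deriv (w j) τ| ≤ Λ) ∧ (∀ j τ, Λ⁻¹ ≤ Aa j τ)) → (∃ (m n : Fin N → EuclideanSpace ℝ (Fin 3)), ∀ (u:(Fin N → ℝ → EuclideanSpace ℝ (Fin 3)) → EuclideanSpace ℝ (Fin 3) → EuclideanSpace ℝ (Fin 3)) (v:EuclideanSpace ℝ (Fin 3) → EuclideanSpace ℝ (Fin 3)) (A:Fin N → (EuclideanSpace ℝ (Fin 3) →L[ℝ] EuclideanSpace ℝ (Fin 3))) (T:(Fin N → ℝ → EuclideanSpace ℝ (Fin 3)) → Fin N → ℝ → EuclideanSpace ℝ (Fin 3)), (∀ Z y, u Z y = ∑ k, (Γ*γ k/(4*Real.pi))•∫ σ:ℝ, ((‖y-Z k σ‖^2+Real.exp (-(1+Real.eulerMascheroniConstant-Real.log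 2))*Aa k σ)^(3/2:ℝ))⁻¹•cross (deriv (Z k) σ) (y-Z k σ))→(∀ y, v y = u X y+(1/2:ℝ)•y-α•cross (EuclideanSpace.single 2 1) y)→(∀ j, A j = fderiv ℝ v (X j (c j)))→(∀ Z j τ, T Z j τ = (u Z (Z j τ)+(1/2:ℝ)•Z j τ-α•cross (EuclideanSpace.single 2 1) (Z j τ))-(⟪u Z (Z j τ)+(1/2:ℝ)•Z j τ-α•cross (EuclideanSpace.single 2 1) (Z j τ), deriv (Z j) τ⟫_ℝ/‖deriv (Z j) τ‖^2)•deriv (Z j) τ)→(∀ j, Orthonormal ℝ ![deriv (X j) (c j), m j, n j] ∧ ⟪A j (m j), m j⟫_ℝ+⟪A j (n j), n j⟫_ℝ < 0 ∧ ⟪A j (n j), m j⟫_ℝ * ⟪A j (m j), n j⟫_ℝ < ⟪A j (m j), m j⟫_ℝ * ⟪A j (n j), n j⟫_ℝ))) ↔ NormalBlockMatched :=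
  Iff.rfl

/-- **THE GLUE THEOREM OF THE SPLIT** `SkeletonJ1G ⇐ TangentSkeletonNearStraight, Clause13NearStraight, NormalBlockMatched`,
with the three children written out in route vocabulary exactly as filed (`--glue-by` target). [folklore] -/
theorem skeletonJ1G_of_subs :
    (open Literature.Analysis.FluidPDE in ∀ (N : ℕ) (δd ρd Λd Rwd θd mw : ℝ) (p t : Fin N → EuclideanSpace ℝ (Fin 3)) (γ : Fin N → ℝ) (α : ℝ) (s₀ : Fin N → ℝ), 0 < N → 0 < δd → 0 < ρd → 0 < Rwd → 0 < θd → 0 < mw → ((∀ j, ‖t j‖ = 1) ∧ (∀ j k, j ≠ k → ∀ τ σ : ℝ, ρd ≤ ‖(p j + τ • t j) - (p k + σ • t k)‖) ∧ (∀ j, |⟪t j, EuclideanSpace.single 2 1⟫_ℝ| ≤ 1 - θd) ∧ (θd ≤ |α| ∧ |α| ≤ θd⁻¹ ∧ ∀ j, θd ≤ |γ j| ∧ |γ j| ≤ θd⁻¹) ∧ (∀ j, ‖p j + s₀ j • t j‖ ≤ Rwd) ∧ (∀ W : Fin N → ℝ → ℝ, (∀ j s, W j s = ⟪(∑ k ∈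 Finset.univ.erase j, (γ k / (2 * Real.pi)) • ((‖(p j + s • t j - p k) - ⟪p j + s • t j - p k, t k⟫_ℝ • t k‖ ^ 2)⁻¹ • cross (t k) ((p j + s • t j - p k) - ⟪p j + s • t j - p k, t k⟫_ℝ • t k))) + (1 / 2 : ℝ) • (p j + s • t j) - α • cross (EuclideanSpace.single 2 1) (p j + s • t j), t j⟫_ℝ) → ∀ j, W j (s₀ j) = 0 ∧ (∀ s, mw * |s - s₀ j| ≤ |W j s|) ∧ 3 / 2 + δd ≤ deriv (W j) (s₀ j) ∧ (∀ s, |deriv (W j) s| ≤ Λd))) → (∀ j k, j ≠ k → |⟪t j, t k⟫_ℝ| ≤ 1 - θd) → ∃ (δ ρ K Λ Rw cg θ₀ KA Rb₁ : ℝ), 0 < δ ∧ 0 < ρ ∧ 0 < Rw ∧ 0 < cg ∧ 0 < θ₀ ∧ 0 < Rb₁ ∧ 2 * K * ρ ≤ 1 ∧ ∀ Rb : ℝ, 0 < Rb → Rb ≤ Rb₁ → ∃ Γ₂ : ℝ, ∀ Γ : ℝ, Γ₂ ≤ Γ → ∃ (X : Fin N → ℝ → EuclideanSpace ℝ (Fin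 3)) (w : Fin N → ℝ → ℝ) (c : Fin N → ℝ) (Aa : Fin N → ℝ → ℝ), (∀ (u:(Fin N → ℝ → EuclideanSpace ℝ (Fin 3)) → EuclideanSpace ℝ (Fin 3) → EuclideanSpace ℝ (Fin 3)) (v:EuclideanSpace ℝ (Fin 3) → EuclideanSpace ℝ (Fin 3)) (A:Fin N → (EuclideanSpace ℝ (Fin 3) →L[ℝ] EuclideanSpace ℝ (Fin 3))) (T:(Fin N → ℝ → EuclideanSpace ℝ (Fin 3)) → Fin N → ℝ → EuclideanSpace ℝ (Fin 3)), (∀ Z y, u Z y = ∑ k, (Γ*γ k/(4*Real.pi))•∫ σ:ℝ, ((‖y-Z k σ‖^2+Real.exp (-(1+Real.eulerMascheroniConstant-Real.log 2))*Aa k σ)^(3/2:ℝ))⁻¹•cross (deriv (Z k) σ) (y-Z k σ))→(∀ y, v y = u X y+(1/2:ℝ)•y-α•cross (EuclideanSpace.single 2 1) y)→(∀ j, A j = fderiv ℝ v (X j (c j)))→(∀ Z j τ, T Z j τ = (u Z (Z j τ)+(1/2:ℝ)•Z j τ-α•cross (EuclideanSpace.single 2 1) (Z j τ))-(⟪u Z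 (Z j τ)+(1/2:ℝ)•Z j τ-α•cross (EuclideanSpace.single 2 1) (Z j τ), deriv (Z j) τ⟫_ℝ/‖deriv (Z j) τ‖^2)•deriv (Z j) τ)→(α ≠ 0 ∧ (∀ j, γ j ≠ 0) ∧ (∀ j, ContDiff ℝ 2 (X j) ∧ Differentiable ℝ (w j)∧(∀ τ, ‖deriv (X j) τ‖ = 1)∧(∀ τ, ‖iteratedDeriv 2 (X j) τ‖*√Γ≤K) ∧ Tendsto (fun τ => ‖X j τ‖) (cocompact ℝ) atTop) ∧ (∀ j k, j ≠ k → ∀ τ σ, ρ*√Γ≤‖X j τ-X k σ‖) ∧ (∀ j τ σ, ρ*√Γ≤|τ-σ| → cg*ρ*√Γ≤‖X j τ-X j σ‖) ∧ (∀ j τ, cg*|τ-c j|≤Rw*√Γ+‖X j τ‖) ∧ (∀ j τ, w j τ = ⟪v (X j τ), deriv (X j) τ⟫_ℝ) ∧ (∀ j τ, ‖X j τ‖≤Rb*√(Γ*Real.log Γ) → v (X j τ) = w j τ•deriv (X j) τ) ∧ (∀ j, ‖X j (c j)‖≤Rw*√Γ) ∧ (∀ j, |⟪deriv (X j) (c j),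 EuclideanSpace.single 2 1⟫_ℝ|≤1-θ₀) ∧ (θ₀≤|α| ∧ |α|≤θ₀⁻¹ ∧ ∀ j, θ₀≤|γ j| ∧ |γ j|≤θ₀⁻¹) ∧ (∀ j, w j (c j) = 0 ∧ (∀ τ, w j τ = 0 → τ = c j) ∧ 3/2+δ≤deriv (w j) (c j) ∧ deriv (w j) (c j)≤Λ) ∧ (∀ j, Differentiable ℝ (Aa j) ∧ (∀ τ, 0 < Aa j τ) ∧ ∀ τ, w j τ*deriv (Aa j) τ = (3/2-deriv (w j) τ)*Aa j τ+4) ∧ (∀ j τ, Rw^2*Γ*Aa j τ≤KA*(Rw^2*Γ+‖X j τ‖^2)))) ∧ ((∀ j τ σ, ‖deriv (X j) τ - deriv (X j) σ‖ ≤ Rb) ∧ (∀ j τ, |deriv (w j) τ| ≤ Λ) ∧ (∀ j τ, Λ⁻¹ ≤ Aa j τ))) →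
    (open Literature.Analysis.FluidPDE in ∀ (N : ℕ) (δ ρ K Λ Rw cg θ₀ KA : ℝ), 0 < N → 0 < δ → 0 < ρ → 0 < Rw → 0 < cg → 0 < θ₀ → ∃ Rb₀ : ℝ, 0 < Rb₀ ∧ ∀ Rb : ℝ, 0 < Rb → Rb ≤ Rb₀ → ∃ (a b cnd Γ₀ : ℝ), 0 ≤ a ∧ 0 < cnd ∧ ∀ Γ : ℝ, Γ₀ ≤ Γ → ∀ (γ : Fin N → ℝ) (α : ℝ) (X : Fin N → ℝ → EuclideanSpace ℝ (Fin 3)) (w : Fin N → ℝ → ℝ) (c : Fin N → ℝ) (Aa : Fin N → ℝ → ℝ), (∀ (u:(Fin N → ℝ → EuclideanSpace ℝ (Fin 3)) → EuclideanSpace ℝ (Fin 3) → EuclideanSpace ℝ (Fin 3)) (v:EuclideanSpace ℝ (Fin 3) → EuclideanSpace ℝ (Fin 3)) (A:Fin N → (EuclideanSpace ℝ (Fin 3) →L[ℝ] EuclideanSpace ℝ (Fin 3))) (T:(Fin N → ℝ → EuclideanSpace ℝ (Fin 3)) → Fin N → ℝ → EuclideanSpace ℝ (Fin 3)), (∀ Z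 y, u Z y = ∑ k, (Γ*γ k/(4*Real.pi))•∫ σ:ℝ, ((‖y-Z k σ‖^2+Real.exp (-(1+Real.eulerMascheroniConstant-Real.log 2))*Aa k σ)^(3/2:ℝ))⁻¹•cross (deriv (Z k) σ) (y-Z k σ))→(∀ y, v y = u X y+(1/2:ℝ)•y-α•cross (EuclideanSpace.single 2 1) y)→(∀ j, A j = fderiv ℝ v (X j (c j)))→(∀ Z j τ, T Z j τ = (u Z (Z j τ)+(1/2:ℝ)•Z j τ-α•cross (EuclideanSpace.single 2 1) (Z j τ))-(⟪u Z (Z j τ)+(1/2:ℝ)•Z j τ-α•cross (EuclideanSpace.single 2 1) (Z j τ), deriv (Z j) τ⟫_ℝ/‖deriv (Z j) τ‖^2)•deriv (Z j) τ)→(α ≠ 0 ∧ (∀ j, γ j ≠ 0) ∧ (∀ j, ContDiff ℝ 2 (X j) ∧ Differentiable ℝ (w j)∧(∀ τ, ‖deriv (X j) τ‖ = 1)∧(∀ τ, ‖iteratedDeriv 2 (X j) τ‖*√Γ≤K) ∧ Tendsto (fun τ => ‖X j τ‖) (cocompact ℝ) atTop) ∧ (∀ j k, j ≠ k → ∀ τ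 σ, ρ*√Γ≤‖X j τ-X k σ‖) ∧ (∀ j τ σ, ρ*√Γ≤|τ-σ| → cg*ρ*√Γ≤‖X j τ-X j σ‖) ∧ (∀ j τ, cg*|τ-c j|≤Rw*√Γ+‖X j τ‖) ∧ (∀ j τ, w j τ = ⟪v (X j τ), deriv (X j) τ⟫_ℝ) ∧ (∀ j τ, ‖X j τ‖≤Rb*√(Γ*Real.log Γ) → v (X j τ) = w j τ•deriv (X j) τ) ∧ (∀ j, ‖X j (c j)‖≤Rw*√Γ) ∧ (∀ j, |⟪deriv (X j) (c j), EuclideanSpace.single 2 1⟫_ℝ|≤1-θ₀) ∧ (θ₀≤|α| ∧ |α|≤θ₀⁻¹ ∧ ∀ j, θ₀≤|γ j| ∧ |γ j|≤θ₀⁻¹) ∧ (∀ j, w j (c j) = 0 ∧ (∀ τ, w j τ = 0 → τ = c j) ∧ 3/2+δ≤deriv (w j) (c j) ∧ deriv (w j) (c j)≤Λ) ∧ (∀ j, Differentiable ℝ (Aa j) ∧ (∀ τ, 0 < Aa j τ) ∧ ∀ τ, w j τ*deriv (Aa j) τ = (3/2-deriv (w j) τ)*Aa j τ+4) ∧ (∀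 j τ, Rw^2*Γ*Aa j τ≤KA*(Rw^2*Γ+‖X j τ‖^2)))) → ((∀ j τ σ, ‖deriv (X j) τ - deriv (X j) σ‖ ≤ Rb) ∧ (∀ j τ, |deriv (w j) τ| ≤ Λ) ∧ (∀ j τ, Λ⁻¹ ≤ Aa j τ)) → (∀ (u:(Fin N → ℝ → EuclideanSpace ℝ (Fin 3)) → EuclideanSpace ℝ (Fin 3) → EuclideanSpace ℝ (Fin 3)) (v:EuclideanSpace ℝ (Fin 3) → EuclideanSpace ℝ (Fin 3)) (A:Fin N → (EuclideanSpace ℝ (Fin 3) →L[ℝ] EuclideanSpace ℝ (Fin 3))) (T:(Fin N → ℝ → EuclideanSpace ℝ (Fin 3)) → Fin N → ℝ → EuclideanSpace ℝ (Fin 3)), (∀ Z y, u Z y = ∑ k, (Γ*γ k/(4*Real.pi))•∫ σ:ℝ, ((‖y-Z k σ‖^2+Real.exp (-(1+Real.eulerMascheroniConstant-Real.log 2))*Aa k σ)^(3/2:ℝ))⁻¹•cross (deriv (Z k) σ) (y-Z k σ))→(∀ y, v y = u X y+(1/2:ℝ)•y-α•cross (EuclideanSpace.single 2 1) y)→(∀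 j, A j = fderiv ℝ v (X j (c j)))→(∀ Z j τ, T Z j τ = (u Z (Z j τ)+(1/2:ℝ)•Z j τ-α•cross (EuclideanSpace.single 2 1) (Z j τ))-(⟪u Z (Z j τ)+(1/2:ℝ)•Z j τ-α•cross (EuclideanSpace.single 2 1) (Z j τ), deriv (Z j) τ⟫_ℝ/‖deriv (Z j) τ‖^2)•deriv (Z j) τ)→(∀ Y:Fin N → ℝ → EuclideanSpace ℝ (Fin 3), (∀ j, ContDiff ℝ 2 (Y j))→(∀ j τ, ⟪Y j τ, deriv (X j) τ⟫_ℝ = 0) → (∀ j τ, Rb*√(Γ*Real.log Γ) < ‖X j τ‖ → Y j τ = 0) → ∑ j, ⟪Y j (c j), cross (EuclideanSpace.single 2 1) (X j (c j))⟫_ℝ = 0 → (∀ j τ, ‖Y j τ‖+‖deriv (Y j) τ‖+‖iteratedDeriv 2 (Y j) τ‖≤(1+|τ-c j|)^b) → ∀ L:ℝ, (∀ j τ, ‖deriv (fun s:ℝ => T (fun k σ => X k σ+s•Y k σ) j τ) 0‖≤L*(1+|τ-c j|)^a) → ∀ j τ, ‖Y j τ‖≤cnd*L*(1+|τ-c j|)^b)))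 →
    (open Literature.Analysis.FluidPDE in ∀ (N : ℕ) (δ ρ K Λ Rw Rb cg θ₀ KA : ℝ), 0 < N → 0 < δ → 0 < ρ → 0 < Rw → 0 < Rb → 0 < cg → 0 < θ₀ → 2 * K * ρ ≤ 1 → ∃ Γ₀ : ℝ, ∀ Γ : ℝ, Γ₀ ≤ Γ → ∀ (γ : Fin N → ℝ) (α : ℝ) (X : Fin N → ℝ → EuclideanSpace ℝ (Fin 3)) (w : Fin N → ℝ → ℝ) (c : Fin N → ℝ) (Aa : Fin N → ℝ → ℝ), (∀ (u:(Fin N → ℝ → EuclideanSpace ℝ (Fin 3)) → EuclideanSpace ℝ (Fin 3) → EuclideanSpace ℝ (Fin 3)) (v:EuclideanSpace ℝ (Fin 3) → EuclideanSpace ℝ (Fin 3)) (A:Fin N → (EuclideanSpace ℝ (Fin 3) →L[ℝ] EuclideanSpace ℝ (Fin 3))) (T:(Fin N → ℝ → EuclideanSpace ℝ (Fin 3)) → Fin N → ℝ → EuclideanSpace ℝ (Fin 3)), (∀ Z y, u Z y = ∑ k, (Γ*γ k/(4*Real.pi))•∫ σ:ℝ, ((‖y-Z k σ‖^2+Real.exp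 (-(1+Real.eulerMascheroniConstant-Real.log 2))*Aa k σ)^(3/2:ℝ))⁻¹•cross (deriv (Z k) σ) (y-Z k σ))→(∀ y, v y = u X y+(1/2:ℝ)•y-α•cross (EuclideanSpace.single 2 1) y)→(∀ j, A j = fderiv ℝ v (X j (c j)))→(∀ Z j τ, T Z j τ = (u Z (Z j τ)+(1/2:ℝ)•Z j τ-α•cross (EuclideanSpace.single 2 1) (Z j τ))-(⟪u Z (Z j τ)+(1/2:ℝ)•Z j τ-α•cross (EuclideanSpace.single 2 1) (Z j τ), deriv (Z j) τ⟫_ℝ/‖deriv (Z j) τ‖^2)•deriv (Z j) τ)→(α ≠ 0 ∧ (∀ j, γ j ≠ 0) ∧ (∀ j, ContDiff ℝ 2 (X j) ∧ Differentiable ℝ (w j)∧(∀ τ, ‖deriv (X j) τ‖ = 1)∧(∀ τ, ‖iteratedDeriv 2 (X j) τ‖*√Γ≤K) ∧ Tendsto (fun τ => ‖X j τ‖) (cocompact ℝ) atTop) ∧ (∀ j k, j ≠ k → ∀ τ σ, ρ*√Γ≤‖X j τ-X k σ‖) ∧ (∀ j τ σ, ρ*√Γ≤|τ-σ| → cg*ρ*√Γ≤‖X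 j τ-X j σ‖) ∧ (∀ j τ, cg*|τ-c j|≤Rw*√Γ+‖X j τ‖) ∧ (∀ j τ, w j τ = ⟪v (X j τ), deriv (X j) τ⟫_ℝ) ∧ (∀ j τ, ‖X j τ‖≤Rb*√(Γ*Real.log Γ) → v (X j τ) = w j τ•deriv (X j) τ) ∧ (∀ j, ‖X j (c j)‖≤Rw*√Γ) ∧ (∀ j, |⟪deriv (X j) (c j), EuclideanSpace.single 2 1⟫_ℝ|≤1-θ₀) ∧ (θ₀≤|α| ∧ |α|≤θ₀⁻¹ ∧ ∀ j, θ₀≤|γ j| ∧ |γ j|≤θ₀⁻¹) ∧ (∀ j, w j (c j) = 0 ∧ (∀ τ, w j τ = 0 → τ = c j) ∧ 3/2+δ≤deriv (w j) (c j) ∧ deriv (w j) (c j)≤Λ) ∧ (∀ j, Differentiable ℝ (Aa j) ∧ (∀ τ, 0 < Aa j τ) ∧ ∀ τ, w j τ*deriv (Aa j) τ = (3/2-deriv (w j) τ)*Aa j τ+4) ∧ (∀ j τ, Rw^2*Γ*Aa j τ≤KA*(Rw^2*Γ+‖X j τ‖^2)))) → ((∀ j τ σ, ‖deriv (X j) τ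 - deriv (X j) σ‖ ≤ Rb) ∧ (∀ j τ, |deriv (w j) τ| ≤ Λ) ∧ (∀ j τ, Λ⁻¹ ≤ Aa j τ)) → (∃ (m n : Fin N → EuclideanSpace ℝ (Fin 3)), ∀ (u:(Fin N → ℝ → EuclideanSpace ℝ (Fin 3)) → EuclideanSpace ℝ (Fin 3) → EuclideanSpace ℝ (Fin 3)) (v:EuclideanSpace ℝ (Fin 3) → EuclideanSpace ℝ (Fin 3)) (A:Fin N → (EuclideanSpace ℝ (Fin 3) →L[ℝ] EuclideanSpace ℝ (Fin 3))) (T:(Fin N → ℝ → EuclideanSpace ℝ (Fin 3)) → Fin N → ℝ → EuclideanSpace ℝ (Fin 3)), (∀ Z y, u Z y = ∑ k, (Γ*γ k/(4*Real.pi))•∫ σ:ℝ, ((‖y-Z k σ‖^2+Real.exp (-(1+Real.eulerMascheroniConstant-Real.log 2))*Aa k σ)^(3/2:ℝ))⁻¹•cross (deriv (Z k) σ) (y-Z k σ))→(∀ y, v y = u X y+(1/2:ℝ)•y-α•cross (EuclideanSpace.single 2 1) y)→(∀ j, A j = fderiv ℝ v (X j (c j)))→(∀ Z j τ, T Z j τ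 = (u Z (Z j τ)+(1/2:ℝ)•Z j τ-α•cross (EuclideanSpace.single 2 1) (Z j τ))-(⟪u Z (Z j τ)+(1/2:ℝ)•Z j τ-α•cross (EuclideanSpace.single 2 1) (Z j τ), deriv (Z j) τ⟫_ℝ/‖deriv (Z j) τ‖^2)•deriv (Z j) τ)→(∀ j, Orthonormal ℝ ![deriv (X j) (c j), m j, n j] ∧ ⟪A j (m j), m j⟫_ℝ+⟪A j (n j), n j⟫_ℝ < 0 ∧ ⟪A j (n j), m j⟫_ℝ * ⟪A j (m j), n j⟫_ℝ < ⟪A j (m j), m j⟫_ℝ * ⟪A j (n j), n j⟫_ℝ))) →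
    SkeletonJ1G :=
  fun h2 h3 h4 => skeletonJ1G_of_pieces (tangentSkeletonNearStraight_iff.mp h2) (clause13NearStraight_iff.mp h3)
    (normalBlockMatched_iff.mp h4)

/-! ## §6 By-name bridges to the route's split items (rev 31 split; child 3 restated rev 34) -/

/-- Route child 1 `FilamentSkeletonRss.TangentSkeletonNearStraight` (stmt-28295) is this file's structured predicate. [folklore] -/
theorem route_tangentSkeletonNearStraight_iff :
    Summit.NavierStokesRegularity.NavierStokesRegularity.Theses.FilamentSkeletonRss.TangentSkeletonNearStraight ↔
      TangentSkeletonNearStraight :=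
  Iff.rfl

/-- Route child 2 `FilamentSkeletonRss.Clause13NearStraight` (stmt-28296) is this file's structured predicate. [folklore] -/
theorem route_clause13NearStraight_iff :
    Summit.NavierStokesRegularity.NavierStokesRegularity.Theses.FilamentSkeletonRss.Clause13NearStraight ↔ Clause13NearStraight :=
  Iff.rfl

/-- Route child 3 `FilamentSkeletonRss.NormalBlockMatched` (stmt-28312, the RESHAPED S4 as restated at rev 34) is this file's
structured predicate `FlatJ1G → NearStraightJ1G → Clause12J1G`. [folklore] -/
theorem route_normalBlockMatched_iff :
    Summit.NavierStokesRegularity.NavierStokesRegularity.Theses.FilamentSkeletonRss.NormalBlockMatched ↔ NormalBlockMatched :=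
  Iff.rfl

/-- **The route's glue item `FilamentSkeletonRss.SkeletonJ1GOfNearStraightParts` (stmt-28298) BY NAME**: children ⟹ parent. [folklore] -/
theorem skeletonJ1GOfNearStraightParts_holds :
    Summit.NavierStokesRegularity.NavierStokesRegularity.Theses.FilamentSkeletonRss.SkeletonJ1GOfNearStraightParts :=
  fun h2 h3 h4 => skeletonJ1G_of_pieces (route_tangentSkeletonNearStraight_iff.mp h2) (route_clause13NearStraight_iff.mp h3)
    (route_normalBlockMatched_iff.mp h4)

end Summit.NavierStokesRegularity.NavierStokesRegularity.Theorems.FilamentSkeletonRssSkeletonJ1GSplit
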